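import Literature.Analysis.FluidPDE.BKMClassVorticityTimeLipschitz
import Literature.Analysis.FluidPDE.AxisymNoSwirlTaoBounds
import HarnessLib

/-!
# Continuity in time of the (Bochner) enstrophy in the Beale–Kato–Majda class

Plumbing between the two renderings of the enstrophy used across the claim skeletons and the fluid library —
the lower Lebesgue integral `∫⁻ ‖curl v x‖ₑ²` and the Bochner integral `∫ ‖curl v x‖²` — and the time
continuity of the latter along a classical Navier–Stokes solution with all `L²` Sobolev norms bounded on a
closed slab (Majda–Bertozzi 2002, Thm. 3.5: `v ∈ C([0,T); V^m)`), obtained from the tree's `L²`-Lipschitz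
continuity of the vorticity (`IsClassicalNSSolutionOn.continuousOn_toReal_eLpNorm_curl`,
`BKMClassVorticityTimeLipschitz.lean`). Theorems only (no definitions, no named facts); written so that
skeletons typed with `∫ ‖curl (u t) x‖ ^ 2` (e.g. `Literature.Claims.NS.LucardoOlivaes2026.ensq`) can cite one
public lemma instead of re-proving private copies.

## References
[cite: MajdaBertozziCUP2002, §3.2.2 Thm. 3.5 (PDF p. 92)]
-/

noncomputable section

open Set Filter MeasureTheory
open scoped Topology ENNReal NNReal ContDiff

namespace Literature.Analysis.FluidPDE

/-- For `v ∈ C²` with `Dv ∈ L²`, the lower-integral enstrophy is the Bochner one: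
`∫⁻ ‖curl v‖ₑ² = ofReal (∫ ‖curl v‖²)` (both finite). [cite: MajdaBertozziCUP2002, §3.2.2 Thm. 3.5 (PDF p. 92)] -/
theorem lintegral_enorm_curl_sq_eq_ofReal_integral
    {v : EuclideanSpace ℝ (Fin 3) → EuclideanSpace ℝ (Fin 3)} (hv : ContDiff ℝ 2 v)
    (h1 : ∫⁻ x, ‖iteratedFDeriv ℝ 1 v x‖ₑ ^ 2 < ⊤) :
    ∫⁻ x, ‖curl v x‖ₑ ^ 2 = ENNReal.ofReal (∫ x, ‖curl v x‖ ^ 2) := by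
  have hint : Integrable (fun x => ‖curl v x‖ ^ 2) := (integrable_norm_curl_sq hv h1).1
  rw [ofReal_integral_eq_lintegral_ofReal hint (ae_of_all _ fun x => sq_nonneg _)]
  refine lintegral_congr fun x => ?_
  rw [← ofReal_norm, ENNReal.ofReal_pow (norm_nonneg _)]

/-- The Bochner enstrophy as the square of the real `L²` norm of the vorticity:
`∫ ‖curl v‖² = (‖curl v‖_{L²})²` for `v ∈ C²` with `Dv ∈ L²`. [cite: MajdaBertozziCUP2002, §3.2.2 Thm. 3.5 (PDF p. 92)] -/
theorem integral_norm_curl_sq_eq_toReal_eLpNorm_sq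
    {v : EuclideanSpace ℝ (Fin 3) → EuclideanSpace ℝ (Fin 3)} (hv : ContDiff ℝ 2 v)
    (h1 : ∫⁻ x, ‖iteratedFDeriv ℝ 1 v x‖ₑ ^ 2 < ⊤) :
    ∫ x, ‖curl v x‖ ^ 2 = ((eLpNorm (curl v) 2 volume).toReal) ^ 2 := by
  rw [eLpNorm_eq_lintegral_rpow_enorm_toReal two_ne_zero ENNReal.ofNat_ne_top, ENNReal.toReal_ofNat,
    ← ENNReal.toReal_rpow, ← Real.rpow_natCast _ 2, ← Real.rpow_mul ENNReal.toReal_nonneg]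
  norm_num
  rw [lintegral_enorm_curl_sq_eq_ofReal_integral hv h1, ENNReal.toReal_ofReal]
  exact integral_nonneg fun x => sq_nonneg _

/-- **The enstrophy `t ↦ ∫ ‖curl u(t)‖²` is continuous on a closed slab in the BKM class** (classical
unforced solution on `[a,b] × ℝ³` with all `L²` Sobolev norms bounded; Majda–Bertozzi 2002 Thm. 3.5 via the
vorticity's `L²`-Lipschitz continuity). [cite: MajdaBertozziCUP2002, §3.2.2 Thm. 3.5 (PDF p. 92)] -/
theorem IsClassicalNSSolutionOn.continuousOn_integral_norm_curl_sq {ν a b : ℝ}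
    {u : ℝ → EuclideanSpace ℝ (Fin 3) → EuclideanSpace ℝ (Fin 3)} {p : ℝ → EuclideanSpace ℝ (Fin 3) → ℝ}
    (hS : IsClassicalNSSolutionOn (Icc a b) ν 0 u p) (hB : HasBoundedSobolevNormsOn (Icc a b) u)
    (hab : a < b) : ContinuousOn (fun t => ∫ x, ‖curl (u t) x‖ ^ 2) (Icc a b) := by
  have h := (hS.continuousOn_toReal_eLpNorm_curl hB hab (n := 2) le_rfl).pow 2
  refine h.congr fun t ht => ?_
  have hsm : ContDiff ℝ ∞ (u t) := hS.contDiff_velocity ht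
  obtain ⟨C₁, hC₁⟩ := hB 1
  have h1 : ∫⁻ x, ‖iteratedFDeriv ℝ 1 (u t) x‖ₑ ^ 2 < ⊤ := (hC₁ t ht).trans_lt ENNReal.coe_lt_top
  have hp : ((2 : ℕ) : ℝ≥0∞) = 2 := by norm_num
  simp only [Pi.pow_apply, hp]
  exact integral_norm_curl_sq_eq_toReal_eLpNorm_sq (hsm.of_le (by norm_cast)) h1

/-- **The enstrophy is continuous on `[0,T)` along a classical solution whose Sobolev norms are bounded on
every closed sub-slab** (the rendering of `v ∈ C([0,T); H^m)` used by the claim skeletons, e.g.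
`Literature.Claims.NS.Chae2007.IsLocalSolution`). [cite: MajdaBertozziCUP2002, §3.2.2 Thm. 3.5 (PDF p. 92)] -/
theorem IsClassicalNSSolutionOn.continuousOn_integral_norm_curl_sq_Ico {ν T : ℝ}
    {u : ℝ → EuclideanSpace ℝ (Fin 3) → EuclideanSpace ℝ (Fin 3)} {p : ℝ → EuclideanSpace ℝ (Fin 3) → ℝ}
    (hS : IsClassicalNSSolutionOn (Ico 0 T) ν 0 u p)
    (hreg : ∀ T'' < T, HasBoundedSobolevNormsOn (Icc 0 T'') u) :
    ContinuousOn (fun t => ∫ x, ‖curl (u t) x‖ ^ 2) (Ico 0 T) := by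
  intro t ht
  -- work on the closed sub-slab `[0, t'']`, `t'' = (t + T)/2`, a neighbourhood of `t` within `[0,T)`
  have ht'' : (t + T) / 2 < T := by linarith [ht.2]
  have htt'' : t < (t + T) / 2 := by linarith [ht.2]
  have hpos : 0 < (t + T) / 2 := lt_of_le_of_lt ht.1 htt''
  have hsub : Icc (0 : ℝ) ((t + T) / 2) ⊆ Ico 0 T := fun s hs => ⟨hs.1, lt_of_le_of_lt hs.2 ht''⟩
  have hc := (hS.mono hsub (uniqueDiffOn_Icc hpos)).continuousOn_integral_norm_curl_sq (hreg _ ht'') hpos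
  have hct : ContinuousWithinAt (fun t => ∫ x, ‖curl (u t) x‖ ^ 2) (Icc 0 ((t + T) / 2)) t :=
    hc t ⟨ht.1, htt''.le⟩
  refine (hct.mono_of_mem_nhdsWithin ?_)
  -- `[0, t''] ∈ 𝓝[Ico 0 T] t`
  exact mem_nhdsWithin.2 ⟨Iio ((t + T) / 2), isOpen_Iio, htt'', fun s hs => ⟨hs.2.1, hs.1.le⟩⟩

end Literature.Analysis.FluidPDE

end
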